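import Literature.Computability.QuantumComplexity.PhaseQueryState
import Literature.Computability.QuantumComplexity.CWrapPost
import Literature.Computability.Complexity.ListFoldBricks
import Literature.Computability.Complexity.HashBricks
import HarnessLib

/-!
# Explicit `k`-fold Forrelation is in `PromiseBQP`, I: the fields of the data word, the dispatch

First file of the instantiation of the phase-query family (`PhaseQuery*.lean`) for explicit `k`-fold
FORRELATION (`AaronsonAmbainis2018_kForrelation_mem`; Aaronson–Ambainis, SIAM J. Comput. 47 (2018),
§6, p. 26 with Prop. 6). The phase machine reads the word `dword x q jv cv mv ++ vg N`
(`PhaseQueryState.lean`); this file takes it apart in the algebra of `FP` string functions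
(`BrickAlgebra.lean`, `PlumbingBricks.lean`): reading backwards, the suffix `vg N` of `CWrapLayout.lean`
makes the word the pairing `⟨1ᴺ, reversed data⟩` (`CWrap.reverse_append_vg`), from which every field
(input `xF`, query registers `q0F q1F q2F`, layer register `jF`, the four bits of copy code and mode)
is cut out by `takeFn`/`dropFn` at unary lengths. Every function is total and in `FP`, with its
value on genuine data words (`*_dword`). Then: the selection of the query register of copy `c`
(`qcF`), the one-bit tests (`isSetF`), and the dispatch on the mode (`dispatchF`) with its four
equations (`dispatchF_dword_W/K/P/Z`).

## References

* S. Aaronson, A. Ambainis, *Forrelation*, SIAM J. Comput. 47 (2018), §6 (p. 26) [AaronsonAmbainis2018].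
* S. Arora, B. Barak, *Computational Complexity: A Modern Approach*, CUP 2009, §1.3 (closure of
  polynomial time under composition) [AroraBarak2009].
-/

noncomputable section

namespace Literature.Computability.QuantumComplexity

open _root_.Computability Polynomial Complexity Complexity.Brick Plumb

namespace ForrMem

open PhaseQuery

/-! ### The fields -/

section Fields

/-- `1ᴺ`, read off the reversed word. [folklore] -/
def NNF (w : List Bool) : List Bool := fstF w.reverse
/-- The data, read off the reversed word. [folklore] -/
def dataF (w : List Bool) : List Bool := (sndF w.reverse).reverse
/-- The input `x` (the first `N` data bits). [folklore] -/
def xF : List Bool → List Bool := takeFn ∘ fanoutFn NNF dataF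
/-- The data after the input. [folklore] -/
def r1F : List Bool → List Bool := dropFn ∘ fanoutFn NNF dataF
/-- `1^{Wq}` for `Wq = N + 8`. [folklore] -/
def WqUF (w : List Bool) : List Bool := NNF w ++ ones 8
/-- Query register `0`. [folklore] -/
def q0F : List Bool → List Bool := takeFn ∘ fanoutFn WqUF r1F
/-- The data after query register `0`. [folklore] -/
def d1F : List Bool → List Bool := dropFn ∘ fanoutFn WqUF r1F
/-- Query register `1`. [folklore] -/
def q1F : List Bool → List Bool := takeFn ∘ fanoutFn WqUF d1F
/-- The data after query register `1`. [folklore] -/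
def d2F : List Bool → List Bool := dropFn ∘ fanoutFn WqUF d1F
/-- Query register `2`. [folklore] -/
def q2F : List Bool → List Bool := takeFn ∘ fanoutFn WqUF d2F
/-- The data after the query registers. [folklore] -/
def r2F : List Bool → List Bool := dropFn ∘ fanoutFn WqUF d2F
/-- The layer register. [folklore] -/
def jF : List Bool → List Bool := takeFn ∘ fanoutFn NNF r2F
/-- The copy code and the mode (four bits). [folklore] -/
def r3F : List Bool → List Bool := dropFn ∘ fanoutFn NNF r2F
/-- Bit `i < 4` of copy code and mode, as `[]`/`[b]`. [folklore] -/
def bitF (i : ℕ) : List Bool → List Bool := take1Fn ∘ List.tail^[i] ∘ r3F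

/-- `NNF ∈ FP`. [folklore] -/
theorem NNF_mem_FP : NNF ∈ FP := comp_mem_FP fstF_mem_FP _root_.Literature.Computability.QuantumComplexity.reverse_mem_FP
/-- `dataF ∈ FP`. [folklore] -/
theorem dataF_mem_FP : dataF ∈ FP :=
  comp_mem_FP _root_.Literature.Computability.QuantumComplexity.reverse_mem_FP (comp_mem_FP sndF_mem_FP _root_.Literature.Computability.QuantumComplexity.reverse_mem_FP)
/-- `xF ∈ FP`. [folklore] -/
theorem xF_mem_FP : xF ∈ FP := comp_mem_FP takeFn_mem_FP (fanoutFn_mem_FP NNF_mem_FP dataF_mem_FP)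
/-- `r1F ∈ FP`. [folklore] -/
theorem r1F_mem_FP : r1F ∈ FP := comp_mem_FP dropFn_mem_FP (fanoutFn_mem_FP NNF_mem_FP dataF_mem_FP)
/-- `WqUF ∈ FP`. [folklore] -/
theorem WqUF_mem_FP : WqUF ∈ FP := append_mem_FP NNF_mem_FP (const_mem_FP _)
/-- `q0F ∈ FP`. [folklore] -/
theorem q0F_mem_FP : q0F ∈ FP := comp_mem_FP takeFn_mem_FP (fanoutFn_mem_FP WqUF_mem_FP r1F_mem_FP)
/-- `d1F ∈ FP`. [folklore] -/
theorem d1F_mem_FP : d1F ∈ FP := comp_mem_FP dropFn_mem_FP (fanoutFn_mem_FP WqUF_mem_FP r1F_mem_FP)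
/-- `q1F ∈ FP`. [folklore] -/
theorem q1F_mem_FP : q1F ∈ FP := comp_mem_FP takeFn_mem_FP (fanoutFn_mem_FP WqUF_mem_FP d1F_mem_FP)
/-- `d2F ∈ FP`. [folklore] -/
theorem d2F_mem_FP : d2F ∈ FP := comp_mem_FP dropFn_mem_FP (fanoutFn_mem_FP WqUF_mem_FP d1F_mem_FP)
/-- `q2F ∈ FP`. [folklore] -/
theorem q2F_mem_FP : q2F ∈ FP := comp_mem_FP takeFn_mem_FP (fanoutFn_mem_FP WqUF_mem_FP d2F_mem_FP)
/-- `r2F ∈ FP`. [folklore] -/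
theorem r2F_mem_FP : r2F ∈ FP := comp_mem_FP dropFn_mem_FP (fanoutFn_mem_FP WqUF_mem_FP d2F_mem_FP)
/-- `jF ∈ FP`. [folklore] -/
theorem jF_mem_FP : jF ∈ FP := comp_mem_FP takeFn_mem_FP (fanoutFn_mem_FP NNF_mem_FP r2F_mem_FP)
/-- `r3F ∈ FP`. [folklore] -/
theorem r3F_mem_FP : r3F ∈ FP := comp_mem_FP dropFn_mem_FP (fanoutFn_mem_FP NNF_mem_FP r2F_mem_FP)
/-- Iterated tails are polynomial time. [folklore] -/
theorem tail_iterate_mem_FP : ∀ i : ℕ, (List.tail^[i] : List Bool → List Bool) ∈ FP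
  | 0 => PolyTimeComputable.id _
  | i + 1 => by rw [Function.iterate_succ']; exact comp_mem_FP PRelSigma.tail_mem_FP (tail_iterate_mem_FP i)
/-- `bitF i ∈ FP`. [folklore] -/
theorem bitF_mem_FP (i : ℕ) : bitF i ∈ FP := comp_mem_FP take1Fn_mem_FP (comp_mem_FP (tail_iterate_mem_FP i) r3F_mem_FP)

variable (P : Params) (x : List Bool) (q : ℕ → List Bool) (jv cv mv : List Bool)

local notation "N" => x.length

/-- The word read by the machine: data word, then the suffix. [folklore] -/
abbrev wd : List Bool := dword x q jv cv mv ++ CWrap.vg N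

/-- `NNF` on a data word. [folklore] -/
theorem NNF_wd : NNF (wd x q jv cv mv) = ones N := by
  rw [NNF, show (wd x q jv cv mv).reverse = (dword x q jv cv mv ++ CWrap.vg N).reverse from rfl, CWrap.reverse_append_vg,
    fstF_boolPair]

/-- `dataF` on a data word. [folklore] -/
theorem dataF_wd : dataF (wd x q jv cv mv) = dword x q jv cv mv := by
  rw [dataF, show (wd x q jv cv mv).reverse = (dword x q jv cv mv ++ CWrap.vg N).reverse from rfl, CWrap.reverse_append_vg,
    sndF_boolPair, List.reverse_reverse]

variable (hq : ∀ c, (q c).length = Wq P x.length) (hjv : jv.length = Ly P x.length) (hcv : cv.length = 2)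
variable (hP : P.cW = 8 ∧ P.cL = 0)
include hq hjv hP

omit hq hjv hP in
/-- `xF` returns the input. [folklore] -/
theorem xF_wd : xF (wd x q jv cv mv) = x := by
  rw [xF, Function.comp_apply, fanoutFn_apply, NNF_wd, dataF_wd, takeFn_boolPair, dword]
  simp [ones, List.take_left']

omit hq hjv hP in
/-- `r1F` returns the data after the input. [folklore] -/
theorem r1F_wd : r1F (wd x q jv cv mv) = q 0 ++ (q 1 ++ (q 2 ++ (jv ++ (cv ++ mv)))) := by
  rw [r1F, Function.comp_apply, fanoutFn_apply, NNF_wd, dataF_wd, dropFn_boolPair, dword]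
  simp [ones, List.drop_left']

omit hq hjv in
/-- `WqUF` returns `1^{Wq}`. [folklore] -/
theorem WqUF_wd : WqUF (wd x q jv cv mv) = ones (Wq P N) := by
  rw [WqUF, NNF_wd]; simp [ones, Wq, hP.1, List.replicate_add]

omit hjv in
/-- The query registers. [folklore] -/
theorem qF_wd : q0F (wd x q jv cv mv) = q 0 ∧ q1F (wd x q jv cv mv) = q 1 ∧ q2F (wd x q jv cv mv) = q 2 ∧
    r2F (wd x q jv cv mv) = jv ++ (cv ++ mv) := by
  have h0 := hq 0; have h1 := hq 1; have h2 := hq 2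
  have hW : (ones (Wq P N)).length = Wq P N := by simp [ones]
  have eW := WqUF_wd P x q jv cv mv hP
  have e1 : d1F (wd x q jv cv mv) = q 1 ++ (q 2 ++ (jv ++ (cv ++ mv))) := by
    rw [d1F, Function.comp_apply, fanoutFn_apply, eW, r1F_wd, dropFn_boolPair, hW, List.drop_left' h0]
  have e2 : d2F (wd x q jv cv mv) = q 2 ++ (jv ++ (cv ++ mv)) := by
    rw [d2F, Function.comp_apply, fanoutFn_apply, eW, e1, dropFn_boolPair, hW, List.drop_left' h1]
  refine ⟨?_, ?_, ?_, ?_⟩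
  · rw [q0F, Function.comp_apply, fanoutFn_apply, eW, r1F_wd, takeFn_boolPair, hW, List.take_left' h0]
  · rw [q1F, Function.comp_apply, fanoutFn_apply, eW, e1, takeFn_boolPair, hW, List.take_left' h1]
  · rw [q2F, Function.comp_apply, fanoutFn_apply, eW, e2, takeFn_boolPair, hW, List.take_left' h2]
  · rw [r2F, Function.comp_apply, fanoutFn_apply, eW, e2, dropFn_boolPair, hW, List.drop_left' h2]

/-- The layer register. [folklore] -/
theorem jF_wd : jF (wd x q jv cv mv) = jv := by
  have e := (qF_wd P x q jv cv mv hq hP).2.2.2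
  have hN : (ones N).length = jv.length := by simp [ones, hjv, Ly, hP.2]
  rw [jF, Function.comp_apply, fanoutFn_apply, NNF_wd, e, takeFn_boolPair, hN, List.take_left]

/-- The copy code and the mode. [folklore] -/
theorem r3F_wd : r3F (wd x q jv cv mv) = cv ++ mv := by
  have e := (qF_wd P x q jv cv mv hq hP).2.2.2
  have hN : (ones N).length = jv.length := by simp [ones, hjv, Ly, hP.2]
  rw [r3F, Function.comp_apply, fanoutFn_apply, NNF_wd, e, dropFn_boolPair, hN, List.drop_left]

include hcv in
/-- The four bits: copy code `(cv₀, cv₁)`, mode `(mv₀, mv₁)`. [folklore] -/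
theorem bitF_wd (m0 m1 : Bool) (hmv : mv = [m0, m1]) :
    bitF 0 (wd x q jv cv mv) = [cv.getD 0 false] ∧ bitF 1 (wd x q jv cv mv) = [cv.getD 1 false] ∧
    bitF 2 (wd x q jv cv mv) = [m0] ∧ bitF 3 (wd x q jv cv mv) = [m1] := by
  have e := r3F_wd P x q jv cv mv hq hjv hP
  obtain ⟨c0, c1, rfl⟩ : ∃ a b, cv = [a, b] := by
    rcases cv with _ | ⟨a, _ | ⟨b, _ | ⟨c, l⟩⟩⟩ <;> simp at hcv; exact ⟨a, b, rfl⟩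
  subst hmv
  simp [bitF, take1Fn, e]

end Fields

/-! ### One-bit tests, the query register of a copy, the dispatch -/

section Dispatch

/-- The test "`f` returns `[true]`" as a one-bit condition (value equality with `1`). [folklore] -/
def isSetF (f : List Bool → List Bool) : List Bool → List Bool := eqValFn ∘ fanoutFn f fun _ => [true]

/-- `isSetF f` is one-bit. [folklore] -/
theorem oneBit_isSetF (f : List Bool → List Bool) : OneBit (isSetF f) := oneBit_eqValFn.comp _

/-- `isSetF f ∈ FP`. [folklore] -/
theorem isSetF_mem_FP {f : List Bool → List Bool} (hf : f ∈ FP) : isSetF f ∈ FP :=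
  comp_mem_FP eqValFn_mem_FP (fanoutFn_mem_FP hf (const_mem_FP _))

/-- Value of `isSetF` when `f` returns a single bit. [folklore] -/
theorem isSetF_of_eq {f : List Bool → List Bool} {w : List Bool} {b : Bool} (h : f w = [b]) : isSetF f w = [b] := by
  cases b <;> simp [isSetF, fanoutFn_apply, h]

/-- Value of `isSetF` when `f` returns nothing. [folklore] -/
theorem isSetF_of_nil {f : List Bool → List Bool} {w : List Bool} (h : f w = []) : isSetF f w = [false] := by
  simp [isSetF, fanoutFn_apply, h]

/-- **The query register of the copy named by the copy code** (`10 ↦ 1`, `01 ↦ 2`, else `0`). [folklore] -/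
def qcF : List Bool → List Bool := iteFn (isSetF (bitF 0)) q1F (iteFn (isSetF (bitF 1)) q2F q0F)

/-- `qcF ∈ FP`. [folklore] -/
theorem qcF_mem_FP : qcF ∈ FP :=
  iteFn_mem_FP (isSetF_mem_FP (bitF_mem_FP 0)) q1F_mem_FP (iteFn_mem_FP (isSetF_mem_FP (bitF_mem_FP 1)) q2F_mem_FP q0F_mem_FP)

variable (P : Params) (x : List Bool) (q : ℕ → List Bool) (jv mv : List Bool)
variable (hq : ∀ c, (q c).length = Wq P x.length) (hjv : jv.length = Ly P x.length) (hP : P.cW = 8 ∧ P.cL = 0)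
include hq hjv hP

/-- **`qcF` selects the register of copy `c`** (`c < 3`). [folklore] -/
theorem qcF_wd {c : ℕ} (hc : c < 3) (m0 m1 : Bool) : qcF (wd x q jv (ccode c) [m0, m1]) = q c := by
  obtain ⟨e0, e1, -, -⟩ := bitF_wd P x q jv (ccode c) [m0, m1] hq hjv rfl hP m0 m1 rfl
  obtain ⟨f0, f1, f2, -⟩ := qF_wd P x q jv (ccode c) [m0, m1] hq hP
  interval_cases c
  · rw [qcF, iteFn_apply_false (isSetF_of_eq (by simpa [ccode] using e0)),
      iteFn_apply_false (isSetF_of_eq (by simpa [ccode] using e1)), f0]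
  · rw [qcF, iteFn_apply_true (isSetF_of_eq (by simpa [ccode] using e0)), f1]
  · rw [qcF, iteFn_apply_false (isSetF_of_eq (by simpa [ccode] using e0)),
      iteFn_apply_true (isSetF_of_eq (by simpa [ccode] using e1)), f2]

omit hq hjv hP in
/-- **The dispatch on the mode**: `W` on `00`, `K` on `10`, `P` on `01`, `Z` on `11` (the mode bits
are bits `2`, `3` of the code-and-mode field). [folklore] -/
def dispatchF (fW fK fP fZ : List Bool → List Bool) : List Bool → List Bool :=
  iteFn (isSetF (bitF 2)) (iteFn (isSetF (bitF 3)) fZ fK) (iteFn (isSetF (bitF 3)) fP fW)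

omit hq hjv hP in
/-- `dispatchF ∈ FP`. [folklore] -/
theorem dispatchF_mem_FP {fW fK fP fZ : List Bool → List Bool} (hW : fW ∈ FP) (hK : fK ∈ FP) (hPp : fP ∈ FP) (hZ : fZ ∈ FP) :
    dispatchF fW fK fP fZ ∈ FP :=
  iteFn_mem_FP (isSetF_mem_FP (bitF_mem_FP 2)) (iteFn_mem_FP (isSetF_mem_FP (bitF_mem_FP 3)) hZ hK)
    (iteFn_mem_FP (isSetF_mem_FP (bitF_mem_FP 3)) hPp hW)

/-- **The four equations of the dispatch** on data words with a two-bit copy code. [folklore] -/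
theorem dispatchF_wd (fW fK fP fZ : List Bool → List Bool) (cv : List Bool) (hcv : cv.length = 2) :
    dispatchF fW fK fP fZ (wd x q jv cv [false, false]) = fW (wd x q jv cv [false, false]) ∧
    dispatchF fW fK fP fZ (wd x q jv cv [true, false]) = fK (wd x q jv cv [true, false]) ∧
    dispatchF fW fK fP fZ (wd x q jv cv [false, true]) = fP (wd x q jv cv [false, true]) ∧
    dispatchF fW fK fP fZ (wd x q jv cv [true, true]) = fZ (wd x q jv cv [true, true]) := by
  have key : ∀ m0 m1 : Bool, bitF 2 (wd x q jv cv [m0, m1]) = [m0] ∧ bitF 3 (wd x q jv cv [m0, m1]) = [m1] := fun m0 m1 =>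
    ⟨(bitF_wd P x q jv cv [m0, m1] hq hjv hcv hP m0 m1 rfl).2.2.1, (bitF_wd P x q jv cv [m0, m1] hq hjv hcv hP m0 m1 rfl).2.2.2⟩
  refine ⟨?_, ?_, ?_, ?_⟩
  · rw [dispatchF, iteFn_apply_false (isSetF_of_eq (key false false).1), iteFn_apply_false (isSetF_of_eq (key false false).2)]
  · rw [dispatchF, iteFn_apply_true (isSetF_of_eq (key true false).1), iteFn_apply_false (isSetF_of_eq (key true false).2)]
  · rw [dispatchF, iteFn_apply_false (isSetF_of_eq (key false true).1), iteFn_apply_true (isSetF_of_eq (key false true).2)]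
  · rw [dispatchF, iteFn_apply_true (isSetF_of_eq (key true true).1), iteFn_apply_true (isSetF_of_eq (key true true).2)]

end Dispatch

end ForrMem

end Literature.Computability.QuantumComplexity
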